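import Mathlib.Analysis.Complex.Basic
import Literature.Probability.RandomPlanarGeometry.CurveSpace
import HarnessLib

/-!
# Which `CurveClass E` are inhabited: the carrier witness and the empty parameter region

`Literature.Probability.RandomPlanarGeometry.CurveClass E` (`CurveSpace.lean`) is the space of
curves in a pseudo-metric space `E` modulo increasing reparametrisation, realised as
`SeparationQuotient (Curve E)`; it is the carrier over which the scaling-limit items of
`CriticalPhenomena` quantify (`Measure (CurveClass ℂ)`, `CurveClass ℂ →ᵇ ℝ`,
`∀ γ : CurveClass ℂ, …`). This file settles, by kernel-checked theorems, WHERE in the parameter `E`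
the carrier is inhabited.

* `CurveClass_nonempty`: for every NONEMPTY pseudo-metric space `E`, `CurveClass E` is inhabited, by
  the class `CurveClass.mk (Curve.const x)` of the constant curve at a point `x` (Aizenman–Burchard,
  Duke Math. J. 99 (1999), §2.1: the space `S_Λ` of curves in a region `Λ`). Registered as the
  instances `Curve.instNonempty`, `CurveClass.instNonempty` (and `Inhabited` versions), so that
  `Nonempty (CurveClass ℂ)` — the parameter of every item of the summit — is found by instance
  resolution (`CurveClass_complex_nonempty` and the `example`s at the end).
* `CurveClass_isEmpty`: for EMPTY `E` the carrier is empty (a curve has a starting point). This is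
  the exact empty region: `CurveClass_nonempty_iff : Nonempty (CurveClass E) ↔ Nonempty E` and
  `CurveClass_isEmpty_iff`. Consequently the UNIFORM statement `∀ E, Nonempty (CurveClass E)` is
  false (`not_forall_nonempty_curveClass`, witness `E = Empty`) — but no item lives over that region.
* Size of the carrier: `CurveClass.subsingleton_iff : Subsingleton (CurveClass E) ↔ Subsingleton E`
  and `CurveClass.nontrivial_iff : Nontrivial (CurveClass E) ↔ Nontrivial E` for metric `E`
  (distinct points give distinct constant classes, told apart by `CurveClass.source`; the embedding
  by constant classes is even isometric, `CurveClass.isometry_mk_const`); so `CurveClass ℂ` is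
  nontrivial and the items are not degenerate through their carrier either.
* Non-vacuity of the events of the statement files over the witness: `rangeSubset S` is nonempty iff
  `S` is (`CurveClass.rangeSubset_nonempty_iff`); `hitsBefore A B` is nonempty iff `A \ B` is
  (`CurveClass.hitsBefore_nonempty_iff`); `simple` is nonempty in every nontrivial real normed space,
  in particular in `ℂ` (`CurveClass.simple_nonempty`: the segment `t ↦ x + t • v`), whereas
  `simple = ∅` over a space with at most one point (`CurveClass.simple_eq_empty_of_subsingleton`:
  `[0,1]` does not inject into a point) — and the constant witness itself is never a simple class
  (`CurveClass.mk_const_notMem_simple`).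

## Mathlib

We USE the instances `Nonempty X → Nonempty (SeparationQuotient X)`,
`Subsingleton X → Subsingleton (SeparationQuotient X)` (`Mathlib.Topology.Inseparable`),
`MetricSpace Empty` (`Mathlib.Topology.MetricSpace.Defs`), and `smul_left_injective`,
`Isometry.of_dist_eq`, `ContinuousMap.dist_le`.

## References

* M. Aizenman, A. Burchard, *Hölder regularity and dimension bounds for random curves*, Duke Math.
  J. 99 (1999), §2.1 (the space of curves modulo reparametrisation and its metric).
-/

open Set

noncomputable section

namespace Literature.Probability.RandomPlanarGeometry

variable {E : Type*}

/-! ### Parametrised curves `Curve E` -/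

namespace Curve

section Topological

variable [TopologicalSpace E]

/-- **Curves exist in every nonempty space**: `Curve E` is inhabited by the constant curve
`Curve.const x` at any point `x` (Aizenman–Burchard 1999, §2.1). [folklore] -/
instance instNonempty [Nonempty E] : Nonempty (Curve E) := (‹Nonempty E›).map const

/-- The default curve of an inhabited space: the constant curve at `default`. [folklore] -/
instance instInhabited [Inhabited E] : Inhabited (Curve E) := ⟨const default⟩

/-- **There are no curves in the empty space**: a curve has a starting point `γ.source : E`.
[folklore] -/
instance instIsEmpty [IsEmpty E] : IsEmpty (Curve E) := ⟨fun γ ↦ isEmptyElim γ.source⟩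

/-- `Curve E` is inhabited iff `E` is (constant curve; starting point). [folklore] -/
theorem nonempty_iff : Nonempty (Curve E) ↔ Nonempty E :=
  ⟨fun ⟨γ⟩ ↦ ⟨γ.source⟩, fun ⟨x⟩ ↦ ⟨const x⟩⟩

/-- `Curve E` is empty iff `E` is. [folklore] -/
theorem isEmpty_iff : IsEmpty (Curve E) ↔ IsEmpty E := by
  rw [← not_nonempty_iff, nonempty_iff, not_nonempty_iff]

/-- Over a space with at most one point all curves coincide. [folklore] -/
instance instSubsingleton [Subsingleton E] : Subsingleton (Curve E) :=
  ⟨fun _ _ ↦ Curve.ext (ContinuousMap.ext fun _ ↦ Subsingleton.elim _ _)⟩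

/-- The underlying continuous map of the constant curve is the constant map. [folklore] -/
@[simp] theorem toContinuousMap_const (x : E) :
    (const x).toContinuousMap = ContinuousMap.const unitInterval x := rfl

/-- The starting point of the constant curve at `x` is `x`. [folklore] -/
@[simp] theorem source_const (x : E) : (const x).source = x := rfl

/-- The end point of the constant curve at `x` is `x`. [folklore] -/
@[simp] theorem target_const (x : E) : (const x).target = x := rfl

/-- The trace of the constant curve at `x` is `{x}` (local copy of `Curve.range_const` of
`ChordalCurveFamily.lean`, not imported to keep this file's cone small). [folklore] -/
private theorem const_range (x : E) : (const x).range = {x} := by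
  ext y
  constructor
  · rintro ⟨t, rfl⟩
    simp
  · rintro rfl
    exact ⟨0, rfl⟩

/-- Constant curves at distinct points are distinct: `Curve.const` is injective. [folklore] -/
theorem const_injective : Function.Injective (const : E → Curve E) :=
  fun _ _ h ↦ by simpa using congrArg source h

/-- A space with two points has two distinct curves (the constant ones). [folklore] -/
instance instNontrivial [Nontrivial E] : Nontrivial (Curve E) := const_injective.nontrivial

/-- `Curve E` has at most one element iff `E` has. [folklore] -/
theorem subsingleton_iff : Subsingleton (Curve E) ↔ Subsingleton E :=
  ⟨fun h ↦ ⟨fun _ _ ↦ const_injective (h.elim _ _)⟩, fun _ ↦ inferInstance⟩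

/-- `Curve E` has two distinct elements iff `E` has. [folklore] -/
theorem nontrivial_iff : Nontrivial (Curve E) ↔ Nontrivial E := by
  rw [← not_subsingleton_iff_nontrivial, subsingleton_iff, not_subsingleton_iff_nontrivial]

/-- **No curve in a space with at most one point is simple**: its parametrisation identifies the
distinct parameters `0 ≠ 1` of `unitInterval`. [folklore] -/
theorem not_isSimple_of_subsingleton [Subsingleton E] (γ : Curve E) : ¬ γ.IsSimple := by
  intro h
  have hinj : Function.Injective γ := h
  exact zero_ne_one (congrArg Subtype.val (hinj (Subsingleton.elim (γ 0) (γ 1))))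

/-- **Constant curves are never simple** (`0 ≠ 1` in `unitInterval`). [folklore] -/
theorem not_isSimple_const (x : E) : ¬ (const x).IsSimple := by
  intro h
  have hinj : Function.Injective (const x) := h
  exact zero_ne_one (congrArg Subtype.val (@hinj 0 1 (by simp)))

end Topological

section Normed

variable {V : Type*} [NormedAddCommGroup V] [NormedSpace ℝ V]

/-- The straight curve `t ↦ x + t • v` from `x` to `x + v` in a real normed space. [folklore] -/
def linePath (x v : V) : Curve V :=
  ⟨⟨fun t ↦ x + (t : ℝ) • v,
    continuous_const.add (continuous_subtype_val.smul continuous_const)⟩⟩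

/-- Pointwise formula for the straight curve. [folklore] -/
@[simp] theorem linePath_apply (x v : V) (t : unitInterval) : linePath x v t = x + (t : ℝ) • v :=
  rfl

/-- **Segments are simple curves**: for `v ≠ 0` the straight curve `t ↦ x + t • v` is injective.
[folklore] -/
theorem isSimple_linePath (x : V) {v : V} (hv : v ≠ 0) : (linePath x v).IsSimple := by
  intro s t hst
  simp only [linePath_apply, add_right_inj] at hst
  exact Subtype.ext (smul_left_injective ℝ hv hst)

end Normed

end Curve

/-! ### Curve classes `CurveClass E`: the carrier -/

section PseudoMetric

variable [PseudoMetricSpace E]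

/-- **Carrier witness.** For every nonempty pseudo-metric space `E` the space `CurveClass E` of
curves modulo reparametrisation is inhabited: by the class `CurveClass.mk (Curve.const x)` of the
constant curve at a point `x` (Aizenman–Burchard, Duke Math. J. 99 (1999), §2.1: the complete
separable metric space `S_Λ` of curves in a region `Λ`). The hypothesis `Nonempty E` cannot be
dropped (`CurveClass_isEmpty`, `CurveClass_nonempty_iff`). [folklore] -/
theorem CurveClass_nonempty (E : Type*) [PseudoMetricSpace E] [Nonempty E] :
    Nonempty (CurveClass E) :=
  (‹Nonempty E›).map fun x ↦ CurveClass.mk (Curve.const x)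

/-- **The empty parameter region.** Over the empty space there are no curve classes: every class has
a representative curve (`CurveClass.surjective_mk`), which has a starting point in `E`. Items
quantifying over `CurveClass E` are therefore vacuous exactly when `E` is empty
(`CurveClass_isEmpty_iff`); no item with `E = ℂ` is in this region. [folklore] -/
theorem CurveClass_isEmpty (E : Type*) [PseudoMetricSpace E] [IsEmpty E] :
    IsEmpty (CurveClass E) :=
  ⟨fun c ↦ (CurveClass.surjective_mk c).elim fun γ _ ↦ isEmptyElim γ.source⟩

/-- **Exact inhabited region**: `CurveClass E` is inhabited iff `E` is. [folklore] -/
theorem CurveClass_nonempty_iff (E : Type*) [PseudoMetricSpace E] :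
    Nonempty (CurveClass E) ↔ Nonempty E :=
  ⟨fun ⟨c⟩ ↦ (CurveClass.surjective_mk c).elim fun γ _ ↦ ⟨γ.source⟩,
    fun _ ↦ CurveClass_nonempty E⟩

/-- **Exact empty region**: `CurveClass E` is empty iff `E` is. [folklore] -/
theorem CurveClass_isEmpty_iff (E : Type*) [PseudoMetricSpace E] :
    IsEmpty (CurveClass E) ↔ IsEmpty E := by
  rw [← not_nonempty_iff, CurveClass_nonempty_iff, not_nonempty_iff]

/-- The UNIFORM non-vacuity statement `∀ E, Nonempty (CurveClass E)` is **false**: the empty metric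
space has no curve classes (`CurveClass_isEmpty`). [folklore] -/
theorem not_forall_nonempty_curveClass :
    ¬ ∀ (E : Type) [PseudoMetricSpace E], Nonempty (CurveClass E) :=
  fun h ↦ (h Empty).elim fun c ↦ (CurveClass_isEmpty Empty).false c

namespace CurveClass

/-- Instance form of `CurveClass_nonempty`: `Nonempty (CurveClass E)` for nonempty `E`; it fires on
the items' parameter `CurveClass ℂ`. [folklore] -/
instance instNonempty [Nonempty E] : Nonempty (CurveClass E) := CurveClass_nonempty E

/-- The default curve class of an inhabited space: the class of the constant curve at `default`.
[folklore] -/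
instance instInhabited [Inhabited E] : Inhabited (CurveClass E) := ⟨mk (Curve.const default)⟩

/-- Instance form of `CurveClass_isEmpty`: no curve classes over the empty space. [folklore] -/
instance instIsEmpty [IsEmpty E] : IsEmpty (CurveClass E) := CurveClass_isEmpty E

/-- Over a space with at most one point there is at most one curve class: all curves coincide
already before passing to the quotient (`Curve.instSubsingleton`). [folklore] -/
theorem subsingleton_of_subsingleton [Subsingleton E] : Subsingleton (CurveClass E) :=
  inferInstance

end CurveClass

end PseudoMetric

section Metric

variable [MetricSpace E]

namespace CurveClass

/-- The starting point of the class of the constant curve at `x` is `x`. [folklore] -/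
@[simp] theorem source_mk_const (x : E) : (mk (Curve.const x)).source = x := rfl

/-- The trace of the class of the constant curve at `x` is `{x}` (local copy of
`CurveClass.range_mk_const` of `ChordalKSCondition.lean`, not imported here). [folklore] -/
private theorem mk_const_range (x : E) : (mk (Curve.const x)).range = {x} := by
  rw [range_mk, Curve.const_range]

/-- Distinct points give distinct constant classes: `x ↦ CurveClass.mk (Curve.const x)` is
injective (the classes are told apart by their starting points). [folklore] -/
theorem mk_const_injective : Function.Injective fun x : E ↦ mk (Curve.const x) :=
  fun _ _ h ↦ by simpa using congrArg source h

/-- The distance between constant classes is the distance of the points: the embedding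
`x ↦ CurveClass.mk (Curve.const x)` of `E` into its curve space is isometric (the reparametrisation
distance of Aizenman–Burchard 1999, §2.1, eq. (2.2), between constant parametrisations).
[folklore] -/
@[simp] theorem dist_mk_const_mk_const (x y : E) :
    dist (mk (Curve.const x)) (mk (Curve.const y)) = dist x y := by
  refine le_antisymm ?_ ?_
  · rw [dist_mk_mk]
    refine (Curve.dist_le_dist_toContinuousMap _ _).trans
      ((ContinuousMap.dist_le dist_nonneg).2 fun t ↦ ?_)
    simp
  · simpa using lipschitzWith_source.dist_le_mul (mk (Curve.const x)) (mk (Curve.const y))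

/-- The embedding of `E` into `CurveClass E` by constant classes is an isometry. [folklore] -/
theorem isometry_mk_const : Isometry fun x : E ↦ mk (Curve.const x) :=
  Isometry.of_dist_eq fun x y ↦ dist_mk_const_mk_const x y

/-- **A space with two points has two distinct curve classes** (the constant ones): the carrier
`CurveClass E` of a nontrivial metric space is nontrivial, in particular `CurveClass ℂ`.
[folklore] -/
instance instNontrivial [Nontrivial E] : Nontrivial (CurveClass E) := mk_const_injective.nontrivial

/-- `CurveClass E` has at most one element iff `E` has (metric `E`). [folklore] -/
theorem subsingleton_iff : Subsingleton (CurveClass E) ↔ Subsingleton E :=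
  ⟨fun h ↦ ⟨fun _ _ ↦ mk_const_injective (h.elim _ _)⟩, fun _ ↦ inferInstance⟩

/-- `CurveClass E` has two distinct elements iff `E` has (metric `E`). [folklore] -/
theorem nontrivial_iff : Nontrivial (CurveClass E) ↔ Nontrivial E := by
  rw [← not_subsingleton_iff_nontrivial, subsingleton_iff, not_subsingleton_iff_nontrivial]

/-! ### Non-vacuity of the events over the witness -/

/-- The constant class at `x` stays inside `S` iff `x ∈ S`. [folklore] -/
@[simp] theorem mk_const_mem_rangeSubset_iff {S : Set E} {x : E} :
    mk (Curve.const x) ∈ rangeSubset S ↔ x ∈ S := by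
  rw [mem_rangeSubset, mk_const_range, singleton_subset_iff]

/-- **The event "stays inside `S`" is nonempty iff `S` is**: the constant class at a point of `S`
belongs to it, and any member has its starting point in `S`. [folklore] -/
theorem rangeSubset_nonempty_iff {S : Set E} : (rangeSubset S).Nonempty ↔ S.Nonempty :=
  ⟨fun ⟨c, hc⟩ ↦ ⟨c.source, mem_rangeSubset.1 hc c.source_mem_range⟩,
    fun ⟨_, hx⟩ ↦ ⟨_, mk_const_mem_rangeSubset_iff.2 hx⟩⟩

/-- Every class stays inside the whole space. [folklore] -/
@[simp] theorem rangeSubset_univ : rangeSubset (univ : Set E) = univ :=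
  eq_univ_of_forall fun _ ↦ mem_rangeSubset.2 (subset_univ _)

/-- No class stays inside the empty set (traces are nonempty). [folklore] -/
@[simp] theorem rangeSubset_empty : rangeSubset (∅ : Set E) = ∅ :=
  eq_empty_of_forall_notMem fun c hc ↦
    c.range_nonempty.ne_empty (subset_empty_iff.1 (mem_rangeSubset.1 hc))

/-- **The crossing event "hits `A` before `B`" is nonempty iff `A \ B` is**: a curve hitting `A` at
a time up to which it avoids `B` sits in `A \ B` at that time; conversely the constant class at a
point of `A \ B` hits `A` at time `0` having avoided `B`. [folklore] -/
theorem hitsBefore_nonempty_iff {A B : Set E} : (hitsBefore A B).Nonempty ↔ (A \ B).Nonempty := by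
  constructor
  · rintro ⟨_, γ, ⟨t, htA, htB⟩, rfl⟩
    exact ⟨γ t, htA, htB t le_rfl⟩
  · rintro ⟨x, hxA, hxB⟩
    refine ⟨mk (Curve.const x),
      mk_mem_hitsBefore (γ := Curve.const x) (t := 0) ?_ fun _ _ ↦ ?_⟩
    · simpa using hxA
    · simpa using hxB

/-- The crossing event `hitsBefore A B` is empty iff `A ⊆ B`. [folklore] -/
theorem hitsBefore_eq_empty_iff {A B : Set E} : hitsBefore A B = ∅ ↔ A ⊆ B := by
  rw [← not_nonempty_iff_eq_empty, hitsBefore_nonempty_iff, not_nonempty_iff_eq_empty,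
    sdiff_eq_empty]

/-- **The constant witness is never a simple class**: every representative of the class of
`Curve.const x` has trace `{x}`, hence takes the same value at the parameters `0 ≠ 1`. [folklore] -/
theorem mk_const_notMem_simple (x : E) : mk (Curve.const x) ∉ simple := by
  rintro ⟨γ, hγ, hmk⟩
  have hinj : Function.Injective γ := hγ
  have hr : γ.range = {x} := by rw [← range_mk, hmk, mk_const_range]
  have h0 : γ 0 = x := by simpa [hr] using (Curve.mem_range (γ := γ)).2 ⟨0, rfl⟩
  have h1 : γ 1 = x := by simpa [hr] using (Curve.mem_range (γ := γ)).2 ⟨1, rfl⟩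
  exact zero_ne_one (congrArg Subtype.val (hinj (h0.trans h1.symm)))

/-- **No simple classes over a point**: if `E` has at most one point then `simple = ∅` in
`CurveClass E` (`[0,1]` does not inject into a point), although the carrier itself is inhabited when
`E` is a point — items asserting something of all SIMPLE classes are vacuous there. [folklore] -/
theorem simple_eq_empty_of_subsingleton [Subsingleton E] : (simple : Set (CurveClass E)) = ∅ :=
  eq_empty_of_forall_notMem fun _ ⟨γ, hγ, _⟩ ↦ Curve.not_isSimple_of_subsingleton γ hγ

end CurveClass

end Metric

section Normed

variable {V : Type*} [NormedAddCommGroup V] [NormedSpace ℝ V]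

/-- **Simple classes exist in every nontrivial real normed space** (segments are simple curves):
`CurveClass.simple` is a nonempty event in `CurveClass V`, in particular in `CurveClass ℂ` — items
about simple scaling limits are not vacuous through emptiness of `simple`. [folklore] -/
theorem CurveClass.simple_nonempty [Nontrivial V] :
    (CurveClass.simple : Set (CurveClass V)).Nonempty := by
  obtain ⟨v, hv⟩ := exists_ne (0 : V)
  exact ⟨_, CurveClass.mk_mem_simple (Curve.isSimple_linePath 0 hv)⟩

end Normed

/-! ### The items' parameter `E = ℂ` -/

/-- **The carrier of the `CriticalPhenomena` scaling-limit items is inhabited**: `CurveClass ℂ`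
contains the class of the constant curve at the origin. [folklore] -/
theorem CurveClass_complex_nonempty : Nonempty (CurveClass ℂ) := ⟨CurveClass.mk (Curve.const 0)⟩

-- The instances fire on the item shapes verbatim:
example : Nonempty (CurveClass ℂ) := inferInstance
example : Inhabited (CurveClass ℂ) := inferInstance
example : Nontrivial (CurveClass ℂ) := inferInstance
example : Nonempty (Curve ℂ) := inferInstance
example : Nonempty (MeasureTheory.Measure (CurveClass ℂ)) := inferInstance
example : Nonempty (CurveClass ℂ → MeasureTheory.Measure (CurveClass ℂ)) := inferInstance
example : Nonempty (BoundedContinuousFunction (CurveClass ℂ) ℝ) := inferInstance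
example : (CurveClass.simple : Set (CurveClass ℂ)).Nonempty := CurveClass.simple_nonempty
example : IsEmpty (CurveClass Empty) := inferInstance

end Literature.Probability.RandomPlanarGeometry

end
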